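import Literature.AlgebraicGeometry.HodgeTheory.AlgebraicClassesPullbackHolds
import Literature.AlgebraicGeometry.HodgeTheory.BettiHodgeConjectureProductOfSurfacesOddKunneth
import Literature.AlgebraicGeometry.HodgeTheory.BettiHodgeConjectureSurfaceTimesThreefoldOddKunneth
import Literature.AlgebraicGeometry.HodgeTheory.BettiUniverseKunnethHodgePowersNormalForm
import Literature.AlgebraicGeometry.HodgeTheory.CyclicCoveringHodgeConjecture
import Literature.AlgebraicGeometry.HodgeTheory.LineBundleTotalSpaceBarthLefschetz
import Literature.AlgebraicGeometry.HodgeTheory.GeneralAmbientNoetherLefschetz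
import Literature.AlgebraicGeometry.HodgeTheory.SurjectiveGysinOntoHodgeAndAlgebraicClasses
import HarnessLib

/-!
# Hypothesis-free forms of the product, cyclic-covering and Gysin consumers of Fulton's Cor. 19.2 (b)

Topic `Literature/AlgebraicGeometry/HodgeTheory`. THEOREMS ONLY (no definition, no named fact). Sequel of
`AlgebraicClassesPullbackConsequences`: the theorems of `BettiHodgeConjectureProductOfSurfacesOddKunneth`
(odd Künneth components of Hodge classes on a product with a surface; `HC(S ⊗ S')` for surfaces with
`p_g = 0`, Voisin I Thm. 11.38–11.40), `BettiHodgeConjectureSurfaceTimesThreefoldOddKunneth`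
(`HC(S ⊗ T)` reductions for a surface times a threefold), `BettiUniverseKunnethHodgePowersNormalForm`
(cup products and pull-backs of rational classes with algebraic complexification),
`CyclicCoveringHodgeConjecture` and `LineBundleTotalSpaceBarthLefschetz` (HC inherited by cyclic
coverings / subvarieties of the total space of an ample line bundle, Lazarsfeld *Positivity* II
Thm. 7.1.16), `GeneralAmbientNoetherLefschetz` and `SurjectiveGysinOntoHodgeAndAlgebraicClasses`, each of
which carries the pull-back fact `fulton1998_map_mem_algebraicClasses` as an explicit hypothesis `hF` /
`hFul`, restated WITHOUT it — primed names, statements otherwise verbatim, proofs `foo hF… := foo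
fulton1998_map_mem_algebraicClasses_holds' …` (`AlgebraicClassesPullbackHolds`: Fulton Cor. 19.2 (b) by
deformation to the normal cone). Other named-fact hypotheses (`hLaz`, …) are kept as printed.

## References

* [Fulton1998] W. Fulton, Intersection Theory, 2nd ed. (1998), §19.2 Cor. 19.2 (b).
* [VoisinHodgeI2002] C. Voisin, Hodge Theory and Complex Algebraic Geometry I (2002), §11.3.3
  Thm. 11.38–11.40, Lemma 11.41.
* [Lazarsfeld2004PositivityII] R. Lazarsfeld, Positivity in Algebraic Geometry II, Thm. 7.1.15–7.1.16.
* [BarthPetersVandeVen1984] W. Barth, C. Peters, A. Van de Ven, Compact Complex Surfaces, Ch. I §17.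
-/

noncomputable section

open scoped TensorProduct
open CategoryTheory MonoidalCategory CartesianMonoidalCategory Module Finset
open Literature.AlgebraicTopology.SingularHomology
open Literature.Geometry.Kaehler
open Literature.AlgebraicGeometry.Motives Literature.AlgebraicGeometry.Motives.HodgeStructure
open CategoryTheory CategoryTheory.Limits MonoidalCategory CartesianMonoidalCategory
open CategoryTheory AlgebraicGeometry
open Literature.AlgebraicGeometry.Motives
open Literature.AlgebraicGeometry.Motives.RatFn
open Literature.AlgebraicGeometry.HodgeTheory
open CategoryTheory AlgebraicGeometry Filter
open Literature.AlgebraicGeometry.Motives (IsSmoothProjective ComplexPoints)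

namespace Literature.AlgebraicGeometry.HodgeTheory

open Literature.AlgebraicGeometry.Motives
open Literature.AlgebraicGeometry.Motives.HodgeStructure

/-! ### From `BettiHodgeConjectureProductOfSurfacesOddKunneth` -/

/-- (Hypothesis-free form of `BettiUniverse.ofRatClass_crossMap_mem_algebraicClasses_of_hodge_one_tensor_three`: `fulton1998_map_mem_algebraicClasses` is now a Literature
theorem, `fulton1998_map_mem_algebraicClasses_holds'`.) **The Hodge classes of the Künneth piece `H¹(Y) ⊗ H³(S)` of `H⁴(Y × S)` are algebraic, granted Fulton's pull-back lemma `hF`** (which gives the cup-closure of the algebraic classes of `Y × S`, the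
tree's `cupProduct_algebraicClasses_of_fulton1998`). [cite: VoisinHodgeI2002, §6.2.3 Thm. 6.25 and Rem. 6.27, §11.3.1 Thm. 11.30, §11.3.3 Thm. 11.38–11.40 and p. 287] [cite: Fulton1998, §19.1 Prop. 19.1.2 and Cor. 19.2 (b)]
[cite: VoisinHodgeII2003, §9.2.2 Prop. 9.20–9.21] -/
theorem BettiUniverse.ofRatClass_crossMap_mem_algebraicClasses_of_hodge_one_tensor_three'
    {m d : ℕ} {Y S : SchemeOver ℂ} [HodgeTensorFacts.{0, 0}] (hHD : exists_isReal_hodgeModel)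
    (hY : IsSmoothProjective m Y) (hS : IsSmoothProjective 2 S) (hYS : IsSmoothProjective d (Y ⊗ S))
    {t : bettiCohomology Y 1 ⊗[ℚ] bettiCohomology S 3}
    (ht : t ∈ (BettiUniverse.kunnethSummand hHD hY hS (2 * 2) ⟨(1, 3), HasAntidiagonal.mem_antidiagonal.2 rfl⟩).hodgeClasses 2) :
    ofRatClass (ComplexPoints (Y ⊗ S)) (2 * 2) (BettiUniverse.crossMap Y S (show 1 + 3 = 2 * 2 by norm_num) t) ∈ algebraicClasses (Y ⊗ S) 2 :=
  BettiUniverse.ofRatClass_crossMap_mem_algebraicClasses_of_hodge_one_tensor_three fulton1998_map_mem_algebraicClasses_holds' hHD hY hS hYS ht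

/-- (Hypothesis-free form of `BettiUniverse.ofRatClass_crossMap_mem_algebraicClasses_of_hodge_three_tensor_one`: `fulton1998_map_mem_algebraicClasses` is now a Literature
theorem, `fulton1998_map_mem_algebraicClasses_holds'`.) **The Hodge classes of the Künneth piece `H³(S) ⊗ H¹(Z)` of `H⁴(S × Z)` are algebraic, granted Fulton's pull-back lemma `hF`.** [cite: VoisinHodgeI2002, §6.2.3 Thm. 6.25 and Rem. 6.27, §11.3.1 Thm. 11.30, §11.3.3 Thm. 11.38–11.40 and p. 287]
[cite: Fulton1998, §19.1 Prop. 19.1.2 and Cor. 19.2 (b)] [cite: VoisinHodgeII2003, §9.2.2 Prop. 9.20–9.21] -/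
theorem BettiUniverse.ofRatClass_crossMap_mem_algebraicClasses_of_hodge_three_tensor_one'
    {n d : ℕ} {Z S : SchemeOver ℂ} [HodgeTensorFacts.{0, 0}] (hHD : exists_isReal_hodgeModel)
    (hS : IsSmoothProjective 2 S) (hZ : IsSmoothProjective n Z) (hSZ : IsSmoothProjective d (S ⊗ Z))
    {t : bettiCohomology S 3 ⊗[ℚ] bettiCohomology Z 1}
    (ht : t ∈ (BettiUniverse.kunnethSummand hHD hS hZ (2 * 2) ⟨(3, 1), HasAntidiagonal.mem_antidiagonal.2 rfl⟩).hodgeClasses 2) :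
    ofRatClass (ComplexPoints (S ⊗ Z)) (2 * 2) (BettiUniverse.crossMap S Z (show 3 + 1 = 2 * 2 by norm_num) t) ∈ algebraicClasses (S ⊗ Z) 2 :=
  BettiUniverse.ofRatClass_crossMap_mem_algebraicClasses_of_hodge_three_tensor_one fulton1998_map_mem_algebraicClasses_holds' hHD hS hZ hSZ ht

/-- (Hypothesis-free form of `BettiUniverse.hodgeConjectureFor_tensor_surfaces_of_kunneth_two_two`: `fulton1998_map_mem_algebraicClasses` is now a Literature
theorem, `fulton1998_map_mem_algebraicClasses_holds'`.) **`HC(S ⊗ S')` for two smooth projective surfaces, granted `hF`, as soon as the Hodge classes of the Künneth piece `H²(S) ⊗ H²(S')` map to algebraic classes of `S × S'`.**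
[cite: VoisinHodgeI2002, §11.3.3 Thm. 11.38, Thm. 11.40, Lemma 11.41 and p. 287, §11.3.1 Thm. 11.30, §6.2.3 Thm. 6.25] [cite: Deligne2000, §1] [cite: Fulton1998, §19.1 Prop. 19.1.2 and Cor. 19.2 (b)] -/
theorem BettiUniverse.hodgeConjectureFor_tensor_surfaces_of_kunneth_two_two'
    {S S' : SchemeOver ℂ} [HodgeTensorFacts.{0, 0}] (hHD : exists_isReal_hodgeModel)
    (hS : IsSmoothProjective 2 S) (hS' : IsSmoothProjective 2 S')
    (hSS' : IsSmoothProjective 4 (S ⊗ S'))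
    (halg : ∀ t ∈ (BettiUniverse.kunnethSummand hHD hS hS' (2 * 2) ⟨(2, 2), HasAntidiagonal.mem_antidiagonal.2 rfl⟩).hodgeClasses 2, ofRatClass (ComplexPoints (S ⊗ S')) (2 * 2) (BettiUniverse.crossMap S S' (show 2 + 2 = 2 * 2 by norm_num) t) ∈ algebraicClasses (S ⊗ S') 2) :
    HodgeConjectureFor 4 (S ⊗ S') :=
  BettiUniverse.hodgeConjectureFor_tensor_surfaces_of_kunneth_two_two fulton1998_map_mem_algebraicClasses_holds' hHD hS hS' hSS' halg

/-- (Hypothesis-free form of `BettiUniverse.hodgeConjectureFor_tensor_surfaces_of_finrank_hom_le_of_fulton`: `fulton1998_map_mem_algebraicClasses` is now a Literature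
theorem, `fulton1998_map_mem_algebraicClasses_holds'`.) **`HC(S ⊗ S')` for two surfaces with `dim_ℚ Hom_HS(H²(S), H²(S')) ≤ ρ(S)ρ(S')`, granted `hF`** (g27-#9's theorem without its `H¹ ⊗ H³` conditions).
[cite: VoisinHodgeI2002, §11.3.3 Lemma 11.41, p. 287, Thm. 11.30 and §6.2.3 Thm. 6.25] [cite: Deligne2000, §1] [cite: Fulton1998, §19.1 Prop. 19.1.2 and Cor. 19.2 (b)] -/
theorem BettiUniverse.hodgeConjectureFor_tensor_surfaces_of_finrank_hom_le_of_fulton'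
    {S S' : SchemeOver ℂ} (hHD : exists_isReal_hodgeModel) (hS : IsSmoothProjective 2 S)
    (hS' : IsSmoothProjective 2 S') (hSS' : IsSmoothProjective 4 (S ⊗ S'))
    (h22 : Module.finrank ℚ (HodgeStructure.Hom (BettiUniverse.hodge hHD hS 2) (BettiUniverse.hodge hHD hS' 2)) ≤ Module.finrank ℚ ↥((BettiUniverse.hodge hHD hS 2).hodgeClasses 1) * Module.finrank ℚ ↥((BettiUniverse.hodge hHD hS' 2).hodgeClasses 1)) :
    HodgeConjectureFor 4 (S ⊗ S') :=
  BettiUniverse.hodgeConjectureFor_tensor_surfaces_of_finrank_hom_le_of_fulton fulton1998_map_mem_algebraicClasses_holds' hHD hS hS' hSS' h22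

/-- (Hypothesis-free form of `BettiUniverse.hodgeConjectureFor_tensor_surfaces_of_pg_zero_left_of_fulton`: `fulton1998_map_mem_algebraicClasses` is now a Literature
theorem, `fulton1998_map_mem_algebraicClasses_holds'`.) **`HC(S ⊗ S')` when `p_g(S) = 0`, granted `hF`** — no condition on `q(S)`, `q(S')`, `p_g(S')`: `H²(S)` is purely of type `(1,1)` (all of `H²(S;ℚ)` is divisor classes), so the Hodge classes of
`H²(S) ⊗ H²(S')` are `H²(S) ⊗ NS(S')_ℚ` (Deligne 2.1.13), products of divisor classes. [cite: VoisinHodgeI2002, §11.3.3 Lemma 11.41, p. 287, Thm. 11.30, §6.2.3 Thm. 6.25 and §6.1.3 Cor. 6.13] [cite: DeligneHodgeII1971, 2.1.13]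
[cite: Deligne2000, §1] [cite: Fulton1998, §19.1 Prop. 19.1.2 and Cor. 19.2 (b)] -/
theorem BettiUniverse.hodgeConjectureFor_tensor_surfaces_of_pg_zero_left_of_fulton'
    {S S' : SchemeOver ℂ} (hHD : exists_isReal_hodgeModel) (hS : IsSmoothProjective 2 S)
    (hS' : IsSmoothProjective 2 S') (hSS' : IsSmoothProjective 4 (S ⊗ S'))
    (hpg : (BettiUniverse.hodge hHD hS 2).hodgeNumber 2 0 = 0) :
    HodgeConjectureFor 4 (S ⊗ S') :=
  BettiUniverse.hodgeConjectureFor_tensor_surfaces_of_pg_zero_left_of_fulton fulton1998_map_mem_algebraicClasses_holds' hHD hS hS' hSS' hpg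

/-- (Hypothesis-free form of `BettiUniverse.hodgeConjectureFor_tensor_surfaces_of_pg_zero_right_of_fulton`: `fulton1998_map_mem_algebraicClasses` is now a Literature
theorem, `fulton1998_map_mem_algebraicClasses_holds'`.) **`HC(S ⊗ S')` when `p_g(S') = 0`, granted `hF`** (the mirror statement: the Hodge classes of `H²(S) ⊗ H²(S')` are `NS(S)_ℚ ⊗ H²(S')`). [cite: VoisinHodgeI2002, §11.3.3 Lemma 11.41, p. 287, Thm. 11.30 and §6.2.3 Thm. 6.25]
[cite: DeligneHodgeII1971, 2.1.13] [cite: Deligne2000, §1] [cite: Fulton1998, §19.1 Prop. 19.1.2 and Cor. 19.2 (b)] -/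
theorem BettiUniverse.hodgeConjectureFor_tensor_surfaces_of_pg_zero_right_of_fulton'
    {S S' : SchemeOver ℂ} (hHD : exists_isReal_hodgeModel) (hS : IsSmoothProjective 2 S)
    (hS' : IsSmoothProjective 2 S') (hSS' : IsSmoothProjective 4 (S ⊗ S'))
    (hpg : (BettiUniverse.hodge hHD hS' 2).hodgeNumber 2 0 = 0) :
    HodgeConjectureFor 4 (S ⊗ S') :=
  BettiUniverse.hodgeConjectureFor_tensor_surfaces_of_pg_zero_right_of_fulton fulton1998_map_mem_algebraicClasses_holds' hHD hS hS' hSS' hpg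

/-- (Hypothesis-free form of `BettiUniverse.hodgeConjectureFor_tensor_self_of_pg_zero_of_fulton`: `fulton1998_map_mem_algebraicClasses` is now a Literature
theorem, `fulton1998_map_mem_algebraicClasses_holds'`.) **`HC(S ⊗ S)` for every smooth projective surface with `p_g(S) = 0`, granted `hF`** (ruled surfaces over a curve of any genus, bielliptic surfaces, Enriques, Godeaux, … — the irregularity plays no
role). [cite: VoisinHodgeI2002, §11.3.3 Lemma 11.41, p. 287, Thm. 11.30 and §6.2.3 Thm. 6.25] [cite: Deligne2000, §1] [cite: Fulton1998, §19.1 Prop. 19.1.2 and Cor. 19.2 (b)] -/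
theorem BettiUniverse.hodgeConjectureFor_tensor_self_of_pg_zero_of_fulton'
    {S : SchemeOver ℂ} (hHD : exists_isReal_hodgeModel) (hS : IsSmoothProjective 2 S)
    (hSS : IsSmoothProjective 4 (S ⊗ S)) (hpg : (BettiUniverse.hodge hHD hS 2).hodgeNumber 2 0 = 0) :
    HodgeConjectureFor 4 (S ⊗ S) :=
  BettiUniverse.hodgeConjectureFor_tensor_self_of_pg_zero_of_fulton fulton1998_map_mem_algebraicClasses_holds' hHD hS hSS hpg

end Literature.AlgebraicGeometry.HodgeTheory

namespace Literature.AlgebraicGeometry.HodgeTheory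

open Literature.AlgebraicGeometry.Motives
open Literature.AlgebraicGeometry.Motives.HodgeStructure

/-! ### From `BettiHodgeConjectureSurfaceTimesThreefoldOddKunneth` -/

/-- (Hypothesis-free form of `BettiUniverse.hodgeConjectureFor_surface_tensor_threefold_of_kunneth_pieces`: `fulton1998_map_mem_algebraicClasses` is now a Literature
theorem, `fulton1998_map_mem_algebraicClasses_holds'`.) **`HC(S ⊗ T)` (`S` a surface, `T` a threefold; granted Fulton's pull-back lemma `hF`) as soon as the Hodge classes of the Künneth pieces `H¹(S) ⊗ H³(T)` and `H²(S) ⊗ H²(T)` of `H⁴(S × T)` map to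
algebraic classes.** [cite: VoisinHodgeI2002, §11.3.3 Thm. 11.38, Thm. 11.40, Lemma 11.41 and p. 287, §11.3.1 Thm. 11.30, §6.2.3 Thm. 6.25] [cite: Deligne2000, §1] [cite: Fulton1998, §19.1 Prop. 19.1.2 and Cor. 19.2 (b)] -/
theorem BettiUniverse.hodgeConjectureFor_surface_tensor_threefold_of_kunneth_pieces'
    {S T : SchemeOver ℂ} [HodgeTensorFacts.{0, 0}] (hHD : exists_isReal_hodgeModel)
    (hS : IsSmoothProjective 2 S) (hT : IsSmoothProjective 3 T) (hST : IsSmoothProjective 5 (S ⊗ T))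
    (h13 : ∀ t ∈ (BettiUniverse.kunnethSummand hHD hS hT (2 * 2) ⟨(1, 3), HasAntidiagonal.mem_antidiagonal.2 rfl⟩).hodgeClasses 2, ofRatClass (ComplexPoints (S ⊗ T)) (2 * 2) (BettiUniverse.crossMap S T (show 1 + 3 = 2 * 2 by norm_num) t) ∈ algebraicClasses (S ⊗ T) 2)
    (h22 : ∀ t ∈ (BettiUniverse.kunnethSummand hHD hS hT (2 * 2) ⟨(2, 2), HasAntidiagonal.mem_antidiagonal.2 rfl⟩).hodgeClasses 2, ofRatClass (ComplexPoints (S ⊗ T)) (2 * 2) (BettiUniverse.crossMap S T (show 2 + 2 = 2 * 2 by norm_num) t) ∈ algebraicClasses (S ⊗ T) 2) :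
    HodgeConjectureFor 5 (S ⊗ T) :=
  BettiUniverse.hodgeConjectureFor_surface_tensor_threefold_of_kunneth_pieces fulton1998_map_mem_algebraicClasses_holds' hHD hS hT hST h13 h22

/-- (Hypothesis-free form of `BettiUniverse.hodgeConjectureFor_surface_tensor_threefold_of_hom_of_fulton`: `fulton1998_map_mem_algebraicClasses` is now a Literature
theorem, `fulton1998_map_mem_algebraicClasses_holds'`.) **`HC(S ⊗ T)` for a surface and a threefold with `Hom_HS(H¹(S), H³(T)(1)) = 0` and `dim_ℚ Hom_HS(H²(S), H²(T)) ≤ ρ(S)ρ(T)`, granted Fulton's pull-back lemma `hF`** (g27-#11 / g28-#1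
without the condition `Hom_HS(H¹S, H¹T) = 0`). [cite: VoisinHodgeI2002, §11.3.3 Lemma 11.41, p. 287, Thm. 11.30 and §6.2.3 Thm. 6.25] [cite: Deligne2000, §1] [cite: Fulton1998, §19.1 Prop. 19.1.2 and Cor. 19.2 (b)] -/
theorem BettiUniverse.hodgeConjectureFor_surface_tensor_threefold_of_hom_of_fulton'
    {S T : SchemeOver ℂ} (hHD : exists_isReal_hodgeModel) (hS : IsSmoothProjective 2 S)
    (hT : IsSmoothProjective 3 T) (hST : IsSmoothProjective 5 (S ⊗ T))
    (h13 : Subsingleton (HodgeStructure.Hom (BettiUniverse.hodge hHD hS 1) (((BettiUniverse.hodge hHD hT 3).tateTwist 1).cast (by norm_num))))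
    (h22 : Module.finrank ℚ (HodgeStructure.Hom (BettiUniverse.hodge hHD hS 2) (BettiUniverse.hodge hHD hT 2)) ≤ Module.finrank ℚ ↥((BettiUniverse.hodge hHD hS 2).hodgeClasses 1) * Module.finrank ℚ ↥((BettiUniverse.hodge hHD hT 2).hodgeClasses 1)) :
    HodgeConjectureFor 5 (S ⊗ T) :=
  BettiUniverse.hodgeConjectureFor_surface_tensor_threefold_of_hom_of_fulton fulton1998_map_mem_algebraicClasses_holds' hHD hS hT hST h13 h22

/-- (Hypothesis-free form of `BettiUniverse.hodgeConjectureFor_surface_tensor_threefold_of_pg_zero_of_hom_of_fulton`: `fulton1998_map_mem_algebraicClasses` is now a Literature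
theorem, `fulton1998_map_mem_algebraicClasses_holds'`.) **`HC(S ⊗ T)` if `Hom_HS(H¹(S), H³(T)(1)) = 0` and `p_g(S) = 0`, granted `hF`** (`H²(S)` of pure type `(1,1)` forces `dim Hom_HS(H²S, H²T) = ρ(S)ρ(T)`; the irregularities of `S`, `T` are arbitrary).
[cite: VoisinHodgeI2002, §11.3.3 Lemma 11.41, p. 287, Thm. 11.30 and §6.2.3 Thm. 6.25] [cite: DeligneHodgeII1971, 2.1.13] [cite: Deligne2000, §1] [cite: Fulton1998, §19.1 Prop. 19.1.2 and Cor. 19.2 (b)] -/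
theorem BettiUniverse.hodgeConjectureFor_surface_tensor_threefold_of_pg_zero_of_hom_of_fulton'
    {S T : SchemeOver ℂ} (hHD : exists_isReal_hodgeModel) (hS : IsSmoothProjective 2 S)
    (hT : IsSmoothProjective 3 T) (hST : IsSmoothProjective 5 (S ⊗ T))
    (hpg : (BettiUniverse.hodge hHD hS 2).hodgeNumber 2 0 = 0)
    (h13 : Subsingleton (HodgeStructure.Hom (BettiUniverse.hodge hHD hS 1) (((BettiUniverse.hodge hHD hT 3).tateTwist 1).cast (by norm_num)))) :
    HodgeConjectureFor 5 (S ⊗ T) :=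
  BettiUniverse.hodgeConjectureFor_surface_tensor_threefold_of_pg_zero_of_hom_of_fulton fulton1998_map_mem_algebraicClasses_holds' hHD hS hT hST hpg h13

/-- (Hypothesis-free form of `BettiUniverse.hodgeConjectureFor_surface_tensor_threefold_of_h20_zero_of_hom_of_fulton`: `fulton1998_map_mem_algebraicClasses` is now a Literature
theorem, `fulton1998_map_mem_algebraicClasses_holds'`.) **`HC(S ⊗ T)` if `Hom_HS(H¹(S), H³(T)(1)) = 0` and `h^{2,0}(T) = 0`, granted `hF`** (the mirror: `H²(T)` of pure type `(1,1)`). [cite: VoisinHodgeI2002, §11.3.3 Lemma 11.41, p. 287, Thm. 11.30 and §6.2.3 Thm. 6.25]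
[cite: DeligneHodgeII1971, 2.1.13] [cite: Deligne2000, §1] [cite: Fulton1998, §19.1 Prop. 19.1.2 and Cor. 19.2 (b)] -/
theorem BettiUniverse.hodgeConjectureFor_surface_tensor_threefold_of_h20_zero_of_hom_of_fulton'
    {S T : SchemeOver ℂ} (hHD : exists_isReal_hodgeModel) (hS : IsSmoothProjective 2 S)
    (hT : IsSmoothProjective 3 T) (hST : IsSmoothProjective 5 (S ⊗ T))
    (h20 : (BettiUniverse.hodge hHD hT 2).hodgeNumber 2 0 = 0)
    (h13 : Subsingleton (HodgeStructure.Hom (BettiUniverse.hodge hHD hS 1) (((BettiUniverse.hodge hHD hT 3).tateTwist 1).cast (by norm_num)))) :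
    HodgeConjectureFor 5 (S ⊗ T) :=
  BettiUniverse.hodgeConjectureFor_surface_tensor_threefold_of_h20_zero_of_hom_of_fulton fulton1998_map_mem_algebraicClasses_holds' hHD hS hT hST h20 h13

end Literature.AlgebraicGeometry.HodgeTheory

namespace Literature.AlgebraicGeometry.HodgeTheory.BettiUniverse

/-! ### From `BettiUniverseKunnethHodgePowersNormalForm` -/

/-- (Hypothesis-free form of `ofRatClass_bettiCup_mem_algebraicClasses`: `fulton1998_map_mem_algebraicClasses` is now a Literature
theorem, `fulton1998_map_mem_algebraicClasses_holds'`.) **Cup products of classes with algebraic complexification have algebraic complexification** on a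
smooth projective `Y`, granted the Fulton pull-back fact (used for the diagonal `Y → Y × Y`, Voisin II
Prop. 9.21 (i); the exterior product is algebraic unconditionally, Prop. 9.20).
[cite: VoisinHodgeII2003, proof of Prop. 9.20 and Prop. 9.21 (i)] [cite: Fulton1998, §19.2 Cor. 19.2 (b)] -/
theorem ofRatClass_bettiCup_mem_algebraicClasses'
    {Y : SchemeOver ℂ} {l : ℕ} (hY : IsSmoothProjective l Y) {qa qb q : ℕ}
    (h : 2 * qa + 2 * qb = 2 * q) {a : bettiCohomology Y (2 * qa)} {b : bettiCohomology Y (2 * qb)}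
    (ha : ofRatClass (ComplexPoints Y) (2 * qa) a ∈ algebraicClasses Y qa)
    (hb : ofRatClass (ComplexPoints Y) (2 * qb) b ∈ algebraicClasses Y qb) :
    ofRatClass (ComplexPoints Y) (2 * q) (bettiCup h a b) ∈ algebraicClasses Y q :=
  ofRatClass_bettiCup_mem_algebraicClasses fulton1998_map_mem_algebraicClasses_holds' hY h ha hb

/-- (Hypothesis-free form of `ofRatClass_pull_mem_algebraicClasses`: `fulton1998_map_mem_algebraicClasses` is now a Literature
theorem, `fulton1998_map_mem_algebraicClasses_holds'`.) **Pull-backs of classes with algebraic complexification have algebraic complexification** (smooth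
projective source and target), granted the Fulton pull-back fact. [cite: Fulton1998, §19.2 Cor. 19.2 (b)] -/
theorem ofRatClass_pull_mem_algebraicClasses'
    {X Y : SchemeOver ℂ} {l l' : ℕ} (hX : IsSmoothProjective l' X) (hY : IsSmoothProjective l Y)
    (f : Y ⟶ X) {q : ℕ} {a : bettiCohomology X (2 * q)}
    (ha : ofRatClass (ComplexPoints X) (2 * q) a ∈ algebraicClasses X q) :
    ofRatClass (ComplexPoints Y) (2 * q) (pull f (2 * q) a) ∈ algebraicClasses Y q :=
  ofRatClass_pull_mem_algebraicClasses fulton1998_map_mem_algebraicClasses_holds' hX hY f ha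

end Literature.AlgebraicGeometry.HodgeTheory.BettiUniverse

namespace Literature.AlgebraicGeometry.HodgeTheory.CoveringHC

/-! ### From `CyclicCoveringHodgeConjecture` -/

/-- (Hypothesis-free form of `hodgeConjectureFor_of_isCyclicCovering_odd`: `fulton1998_map_mem_algebraicClasses` is now a Literature
theorem, `fulton1998_map_mem_algebraicClasses_holds'`.) **HC is inherited by cyclic coverings determined by an AMPLE line bundle, in ODD dimension**
(granted Fulton Cor. 19.2 (b) `hFul` and *Positivity* II Thm. 7.1.16 `hLaz`): for smooth projective
`X`, `Y` of odd dimension `m` and `f : X ⟶ Y` the `n`-cyclic covering determined by `𝓛 = 𝒪_Y(D)`,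
`D` ample, `f^*` is bijective on `H²ᵖ` for `2p < m`, so HC(Y) ⇒ HC(X). Instances in print: cyclic
covers of `ℙ^{2k+1}`, of odd-dimensional hypersurfaces and complete intersections, of
odd-dimensional abelian varieties. [cite: BarthPetersVandeVen1984, Ch. I §17 (pp. 101–102)] [cite: Lazarsfeld2004PositivityII, §7.1.B Thm. 7.1.16] -/
theorem hodgeConjectureFor_of_isCyclicCovering_odd'
    {m : ℕ} {X Y : SchemeOver ℂ} [IsIntegral X.left] [IsIntegral Y.left]
    (hLaz : Lazarsfeld2004_barthLefschetz_lineBundleTotalSpace) (f : X ⟶ Y) [IsDominant f.left]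
    (hY : IsSmoothProjective m Y) (hX : IsSmoothProjective m X) {D : CartierDivisor Y.left}
    (hD : D.IsAmple) {n : ℕ} {s : Y.left.functionField} (hf : IsCyclicCovering f.left D n s)
    (hm : Odd m) (hHC : HodgeConjectureFor m Y) :
    HodgeConjectureFor m X :=
  hodgeConjectureFor_of_isCyclicCovering_odd fulton1998_map_mem_algebraicClasses_holds' hLaz f hY hX hD hf hm hHC

/-- (Hypothesis-free form of `hodgeConjectureFor_cyclicCovering_projectiveSpace_odd`: `fulton1998_map_mem_algebraicClasses` is now a Literature
theorem, `fulton1998_map_mem_algebraicClasses_holds'`.) **Every smooth cyclic covering of `ℙ^{2k+1}` determined by an ample `𝒪(D)` satisfies the Hodge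
conjecture** (granted `hFul`, `hLaz`): all its even cohomology below the middle comes from
`ℙ^{2k+1}`, whose classes are algebraic, and there is no middle even degree. (The integrality instance
for `ℙ^{2k+1}` is `Resolution.isIntegral_projectiveSpace`.) [cite: BarthPetersVandeVen1984, Ch. I §17 (pp. 101–102)] [cite: Lazarsfeld2004PositivityII, §7.1.B Thm. 7.1.16 and Rem. 7.1.19] -/
theorem hodgeConjectureFor_cyclicCovering_projectiveSpace_odd'
    {X : SchemeOver ℂ} [IsIntegral X.left]
    (hLaz : Lazarsfeld2004_barthLefschetz_lineBundleTotalSpace) {k : ℕ}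
    [IsIntegral (projectiveSpace (2 * k + 1) ℂ).left] (g : X ⟶ projectiveSpace (2 * k + 1) ℂ)
    [IsDominant g.left] (hX : IsSmoothProjective (2 * k + 1) X)
    {D : CartierDivisor (projectiveSpace (2 * k + 1) ℂ).left} (hD : D.IsAmple) {n : ℕ}
    {s : (projectiveSpace (2 * k + 1) ℂ).left.functionField} (hg : IsCyclicCovering g.left D n s) :
    HodgeConjectureFor (2 * k + 1) X :=
  hodgeConjectureFor_cyclicCovering_projectiveSpace_odd fulton1998_map_mem_algebraicClasses_holds' hLaz g hX hD hg

/-- (Hypothesis-free form of `hodgeConjectureFor_of_isCyclicCovering_even_middle`: `fulton1998_map_mem_algebraicClasses` is now a Literature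
theorem, `fulton1998_map_mem_algebraicClasses_holds'`.) **Even dimension `m = 2k`**: for a cyclic covering `f : X ⟶ Y` determined by an ample `𝒪_Y(D)`,
HC(X) follows from HCᵖ(Y) for `p < k` and the algebraicity of the middle rational `(k,k)` classes
of `X` — the single open degree (granted `hFul`, `hLaz`). [cite: BarthPetersVandeVen1984, Ch. I §17 (pp. 101–102)] [cite: Lazarsfeld2004PositivityII, §7.1.B Thm. 7.1.16] -/
theorem hodgeConjectureFor_of_isCyclicCovering_even_middle'
    {X Y : SchemeOver ℂ} [IsIntegral X.left] [IsIntegral Y.left]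
    (hLaz : Lazarsfeld2004_barthLefschetz_lineBundleTotalSpace) {k : ℕ} (f : X ⟶ Y)
    [IsDominant f.left] (hY : IsSmoothProjective (2 * k) Y) (hX : IsSmoothProjective (2 * k) X)
    {D : CartierDivisor Y.left} (hD : D.IsAmple) {n : ℕ} {s : Y.left.functionField}
    (hf : IsCyclicCovering f.left D n s)
    (hHC : ∀ p : ℕ, p < k → ∀ c₀ : complexBetti Y (2 * p), IsRationalClass c₀ → IsOfHodgeType (2 * k) Y (2 * p) p p c₀ → c₀ ∈ algebraicClasses Y p)
    (hmid : ∀ c : complexBetti X (2 * k), IsRationalClass c → IsOfHodgeType (2 * k) X (2 * k) k k c → c ∈ algebraicClasses X k) :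
    HodgeConjectureFor (2 * k) X :=
  hodgeConjectureFor_of_isCyclicCovering_even_middle fulton1998_map_mem_algebraicClasses_holds' hLaz f hY hX hD hf hHC hmid

end Literature.AlgebraicGeometry.HodgeTheory.CoveringHC

namespace Literature.AlgebraicGeometry.HodgeTheory.CoveringHC

/-! ### From `LineBundleTotalSpaceBarthLefschetz` -/

/-- (Hypothesis-free form of `hodgeConjectureFor_of_embedsInLineBundleTotalSpace_odd`: `fulton1998_map_mem_algebraicClasses` is now a Literature
theorem, `fulton1998_map_mem_algebraicClasses_holds'`.) **HC is inherited by smooth subvarieties of `Tot(L)`, `L` ample, in ODD dimension** (granted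
Thm. 7.1.16 `hLaz` and Fulton Cor. 19.2 (b) `hFul`): `f^*` is bijective on `H²ᵖ` for all `2p < n`, so
HC(Y) ⇒ HC(X) by the odd Lefschetz-package core. Instances in print: cyclic covers of any degree of
`ℙ^{2k+1}`, of odd-dimensional hypersurfaces, of odd-dimensional abelian varieties, branched along a
smooth member of `|L^{⊗a}|`. [cite: Lazarsfeld2004PositivityII, §7.1.B Thm. 7.1.16] [cite: VoisinHodgeI2002, Thm. 6.25, Rem. 6.27 and §7.1.2] -/
theorem hodgeConjectureFor_of_embedsInLineBundleTotalSpace_odd'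
    {n : ℕ} {X Y : SchemeOver ℂ} [IsIntegral X.left] [IsIntegral Y.left]
    (hLaz : Lazarsfeld2004_barthLefschetz_lineBundleTotalSpace) (f : X ⟶ Y) [IsDominant f.left]
    (hY : IsSmoothProjective n Y) (hX : IsSmoothProjective n X) (hf : IsFinite f.left)
    (D : CartierDivisor Y.left) (hD : D.IsAmple) (hemb : EmbedsInLineBundleTotalSpace f.left D)
    (hn : Odd n) (hHC : HodgeConjectureFor n Y) :
    HodgeConjectureFor n X :=
  hodgeConjectureFor_of_embedsInLineBundleTotalSpace_odd fulton1998_map_mem_algebraicClasses_holds' hLaz f hY hX hf D hD hemb hn hHC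

/-- (Hypothesis-free form of `hodgeConjectureFor_of_embedsInLineBundleTotalSpace_even_middle`: `fulton1998_map_mem_algebraicClasses` is now a Literature
theorem, `fulton1998_map_mem_algebraicClasses_holds'`.) **Even dimension `n = 2k`**: with `f^*` bijective below the middle (Thm. 7.1.16), HC(X) follows
from HCᵖ(Y) for `p < k` and the algebraicity of the middle rational `(k,k)` classes of `X` — the
single open degree. [cite: Lazarsfeld2004PositivityII, §7.1.B Thm. 7.1.16] [cite: VoisinHodgeI2002, Thm. 6.25, Rem. 6.27 and §7.1.2] -/
theorem hodgeConjectureFor_of_embedsInLineBundleTotalSpace_even_middle'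
    {X Y : SchemeOver ℂ} [IsIntegral X.left] [IsIntegral Y.left]
    (hLaz : Lazarsfeld2004_barthLefschetz_lineBundleTotalSpace) {k : ℕ} (f : X ⟶ Y)
    [IsDominant f.left] (hY : IsSmoothProjective (2 * k) Y) (hX : IsSmoothProjective (2 * k) X)
    (hf : IsFinite f.left) (D : CartierDivisor Y.left) (hD : D.IsAmple)
    (hemb : EmbedsInLineBundleTotalSpace f.left D)
    (hHC : ∀ p : ℕ, p < k → ∀ c₀ : complexBetti Y (2 * p), IsRationalClass c₀ → IsOfHodgeType (2 * k) Y (2 * p) p p c₀ → c₀ ∈ algebraicClasses Y p)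
    (hmid : ∀ c : complexBetti X (2 * k), IsRationalClass c → IsOfHodgeType (2 * k) X (2 * k) k k c → c ∈ algebraicClasses X k) :
    HodgeConjectureFor (2 * k) X :=
  hodgeConjectureFor_of_embedsInLineBundleTotalSpace_even_middle fulton1998_map_mem_algebraicClasses_holds' hLaz f hY hX hf D hD hemb hHC hmid

end Literature.AlgebraicGeometry.HodgeTheory.CoveringHC

namespace Literature.AlgebraicGeometry.HodgeTheory.HypersurfaceSectionHC

/-! ### From `GeneralAmbientNoetherLefschetz` -/

/-- (Hypothesis-free form of `veryGeneralSection_hodgeConjectureFor_of_lefschetzAmple`: `fulton1998_map_mem_algebraicClasses` is now a Literature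
theorem, `fulton1998_map_mem_algebraicClasses_holds'`.) **HC(X) ∧ `H` Lefschetz-ample ⇒ HC for the very general smooth hyperplane section of `X`**
(`dim X = 2k + 1`, `k ≥ 1`): for all `H` in a residual subset of `(ℙᴺ)^*(ℂ)`, if `X ∩ H` is smooth of
dimension `2k` it satisfies the Hodge conjecture — Voisin Thm. 4.17 (the fact) + the weak Lefschetz
package of the members (tree theorem `universalSectionLefschetzPackage_of_isClosedImmersion`) + the
even-dimensional Lefschetz-package core; modulo the summit-side Fulton hypothesis `hFul`.
[cite: Voisin2013HodgeLociSurvey, §4.3 Thm. 4.17 and Rem. 4.18 (p. 19)] [cite: VoisinHodgeII2003, §1.2.2 Thm. 1.23] -/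
theorem veryGeneralSection_hodgeConjectureFor_of_lefschetzAmple'
    {k N : ℕ} {X : SchemeOver ℂ} (hV : Voisin2013_veryGeneralSection_hodgeClassesFromAmbient)
    (hX : IsSmoothProjective (2 * k + 1) X) (hk : 1 ≤ k) (ι : X ⟶ projectiveSpace N ℂ)
    [IsClosedImmersion ι.left] (hLA : LefschetzAmple k N ι) (hHC : HodgeConjectureFor (2 * k + 1) X) :
    ∀ᶠ H in residual (ComplexPoints (dualProjectiveSpace N ℂ)), H ∈ universalSmoothLocus N ι (2 * k) → HodgeConjectureFor (2 * k) (fiberOver (UniversalHyperplaneSection.proj N ι) H) :=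
  veryGeneralSection_hodgeConjectureFor_of_lefschetzAmple hV fulton1998_map_mem_algebraicClasses_holds' hX hk ι hLA hHC

/-- (Hypothesis-free form of `exists_smooth_section_hodgeConjectureFor_of_lefschetzAmple`: `fulton1998_map_mem_algebraicClasses` is now a Literature
theorem, `fulton1998_map_mem_algebraicClasses_holds'`.) **Existence form**, granted Bertini (`Hartshorne1977_bertini_smoothHyperplaneSections`): under
the same hypotheses there IS a hyperplane `H` with `X ∩ H` smooth of dimension `2k` and satisfying the
Hodge conjecture (a residual subset of the Baire space `(ℙᴺ)^*(ℂ)` meets the dense open smooth locus).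
[cite: Voisin2013HodgeLociSurvey, §4.3 Thm. 4.17 (p. 19)] [cite: Hartshorne1977, II Thm. 8.18] -/
theorem exists_smooth_section_hodgeConjectureFor_of_lefschetzAmple'
    {k N : ℕ} {X : SchemeOver ℂ} (hV : Voisin2013_veryGeneralSection_hodgeClassesFromAmbient)
    (hB : Hartshorne1977_bertini_smoothHyperplaneSections) (hX : IsSmoothProjective (2 * k + 1) X)
    (hk : 1 ≤ k) (ι : X ⟶ projectiveSpace N ℂ) [IsClosedImmersion ι.left]
    (hLA : LefschetzAmple k N ι) (hHC : HodgeConjectureFor (2 * k + 1) X) :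
    ∃ H : ComplexPoints (dualProjectiveSpace N ℂ), H ∈ universalSmoothLocus N ι (2 * k) ∧ HodgeConjectureFor (2 * k) (fiberOver (UniversalHyperplaneSection.proj N ι) H) :=
  exists_smooth_section_hodgeConjectureFor_of_lefschetzAmple hV hB fulton1998_map_mem_algebraicClasses_holds' hX hk ι hLA hHC

end Literature.AlgebraicGeometry.HodgeTheory.HypersurfaceSectionHC

namespace Literature.AlgebraicGeometry.HodgeTheory

/-! ### From `SurjectiveGysinOntoHodgeAndAlgebraicClasses` -/

/-- (Hypothesis-free form of `exists_mem_supportedClasses_complexGysin_eq_of_surjective`: `fulton1998_map_mem_algebraicClasses` is now a Literature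
theorem, `fulton1998_map_mem_algebraicClasses_holds'`.) **Every algebraic class of `W` is the Gysin image of an algebraic class of `X`, granted pull-back of
algebraic classes** (the tree's named fact `fulton1998_map_mem_algebraicClasses`, Fulton Cor. 19.2 (b), as the
hypothesis `hPull`): for `g : X ⟶ W` surjective, `dim X = dim W + r`, and `x ∈ Nᵖ H²ᵖ(W(ℂ); ℂ)` there is
`y ∈ N^{p+r} H^{2p+2r}(X(ℂ); ℂ)` with `g_* y = x` — namely `y = c₀⁻¹ Lʳ_η(g^* x)` (`g^* x` algebraic by
`hPull`, `η` a divisor class so `Lʳ_η` raises the coniveau by `r`, `g_*(Lʳ_η g^* x) = c₀ • x` with `c₀ ≠ 0`).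
[cite: Fulton1998, §19.2 Cor. 19.2 (b)] [cite: Voisin2002, §7.3.2 Lemma 7.28 and Remark 7.29]
[cite: VoisinHodgeII2003, §9.2.4 Prop. 9.20 and Prop. 9.21] -/
theorem exists_mem_supportedClasses_complexGysin_eq_of_surjective'
    {n m : ℕ} {X W : Motives.SchemeOver ℂ} (hX : IsSmoothProjective n X)
    (hW : IsSmoothProjective m W) (g : X ⟶ W) [Surjective g.left] {r : ℕ} (hr : m + r = n) {p : ℕ}
    {x : complexBetti W (2 * p)} (hx : x ∈ algebraicClasses W p) :
    ∃ y ∈ supportedClasses X (2 * p + 2 * r) (p + r), complexGysin complexOrientationFamily hX hW g (show (2 * p + 2 * r) + 2 * m = 2 * p + 2 * n by omega) y = x :=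
  exists_mem_supportedClasses_complexGysin_eq_of_surjective fulton1998_map_mem_algebraicClasses_holds' hX hW g hr hx

/-- (Hypothesis-free form of `map_complexGysin_supportedClasses_eq_algebraicClasses_of_surjective`: `fulton1998_map_mem_algebraicClasses` is now a Literature
theorem, `fulton1998_map_mem_algebraicClasses_holds'`.) **`g_* N^{p+r} H^{2p+2r}(X) = Nᵖ H²ᵖ(W)` along a surjection, granted pull-back of algebraic classes.**
[cite: Fulton1998, §19.2 Cor. 19.2 (b)] [cite: Voisin2002, §7.3.2 Lemma 7.28 and Remark 7.29]
[cite: VoisinHodgeII2003, §9.2.4 Prop. 9.21 (ii)] -/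
theorem map_complexGysin_supportedClasses_eq_algebraicClasses_of_surjective'
    {n m : ℕ} {X W : Motives.SchemeOver ℂ} (hX : IsSmoothProjective n X)
    (hW : IsSmoothProjective m W) (g : X ⟶ W) [Surjective g.left] {r : ℕ} (hr : m + r = n) (p : ℕ) :
    (supportedClasses X (2 * p + 2 * r) (p + r)).map (complexGysin complexOrientationFamily hX hW g (show (2 * p + 2 * r) + 2 * m = 2 * p + 2 * n by omega)) = algebraicClasses W p :=
  map_complexGysin_supportedClasses_eq_algebraicClasses_of_surjective fulton1998_map_mem_algebraicClasses_holds' hX hW g hr p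

end Literature.AlgebraicGeometry.HodgeTheory

end
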